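import Summits.Ventures.LatticeQCDFlow.Exactness.IMHColdStartBurnIn
import Summits.Ventures.LatticeQCDFlow.Scoring.ChainBurnIn
import HarnessLib

/-!
# The cold-started run on path space: the exact time-average bias of flow-MCMC from a mode, against the
# any-start certificate

HONEST FRAMING: exact (Metropolis-corrected) sampling algorithms for lattice gauge theory;
figures of merit are autocorrelation/cost numbers at stated couplings and volumes; no
continuum-physics claim.

Venture `LatticeQCDFlow` (cell pub-lqcd), topic `Exactness`; FANOUT row 30 (lean-1, GEN-31).  NEW WORK of the
cell, general state space.  `IMHModeRenewal` / `IMHColdStartBurnIn` (this generation) computed the one-time laws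
`δ_{x₀}K^t` of the flow-MCMC chain `K = indepMH q w` started at a mode `x₀` of the normalised weight and the exact
summed bias `(f(x₀) − π f)·S_T` of its marginal expectations.  The Scoring row's any-start certificates
(`Scoring/ChainBurnIn`, `Scoring/ChainTimeAverage`) live on PATH SPACE (Mathlib's `Kernel.trajMeasure`): the
random time average `(1/N)Σ_{i<N} f(X_i)` of the trajectory.  This file bridges the two and states the
cold-start law where the certificates live:

* §1 **`integral_iterate_kop_eq_integral_iterate_bind`** — for every Markov kernel, bounded measurable `f` and
  initial law `μ`: `∫ (kop κ)^[t] f dμ = ∫ f d(μK^t)` (observables forward = laws backward); hence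
  (**`chain_expect_eq_integral_iterate_bind`**, with `Scoring/ChainBurnIn.chain_expect`) the time-`t` marginal of
  the trajectory law is `μ₀K^t`: `E_{μ₀}[f(X_t)] = ∫ f d(μ₀K^t)`.
* §2 **`imh_chain_expect_mode_sub`** — flow-MCMC from a mode, on path space: `E_{x₀}[f(X_t)] − π f =
  r^t·(f(x₀) − π f)`, `r = 1 − 1/w(x₀)`; **`imh_chain_timeAverage_bias_mode_eq`** — THE EXPECTED TIME AVERAGE OF
  THE COLD-STARTED RUN IS BIASED BY EXACTLY `(f(x₀) − π f)·S_N/N`, `S_N = Σ_{t<N} r^t = w(x₀)(1 − r^N)`;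
  **`imh_chain_timeAverage_bias_mode_two_sided`** — `|f(x₀) − π f|/(1 + N/w(x₀)) ≤ |bias_N| ≤
  |f(x₀) − π f|·min(1, w(x₀)/N)`.
* §3 **`imh_chain_timeAverage_bias_le_any_start`** — the Scoring row's certificate instantiated with flow-MCMC's
  EXACT Doeblin constant `ε = 1/w(x₀)` (`IMHKernel.indepMH_apply_ge` at the mode): from EVERY initial law,
  `|bias_N| ≤ 2(C + |π f|)·w(x₀)/N` for `|f| ≤ C`.  By §2 the cold start attains this within the factor
  `2(C + |π f|)(1 + w(x₀)/N)/|f(x₀) − π f|` (`≤ 8C/|f(x₀) − π f|` once `N ≥ w(x₀)`): THE ANY-START BIAS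
  CERTIFICATE IS SHARP IN ITS `w(x₀)/N` LAW, and the constant that makes it sharp is the exact sampler's own
  `1/A(x₀) = w(x₀)`.

Reading (gauge files): `w(cold) = c^{#B}M^k/Z` resp. `∏_ℓ c_{#C_ℓ}/Z` for the two exact gauge samplers — the
certified `O(w(cold)/N)` thermalisation bias of ANY start is what the cold start actually incurs.  NOT CLAIMED: the
mean-square error (two-time laws; the row's `chain_mse_le_of_doeblin` applies with the same `ε` but is not
restated here); non-modal starts beyond the certificate.

No `sorry`, no new definitions, nothing cited as a fact.
-/

noncomputable section

namespace Summit.Ventures.LatticeQCDFlow.Exactness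

open MeasureTheory ProbabilityTheory Function Finset
open scoped ENNReal
open Summit.Ventures.LatticeQCDFlow.Scoring

variable {Ω : Type*} [MeasurableSpace Ω]

/-! ## §1 Observables forward = laws backward; the time-`t` marginal of the trajectory law -/

/-- **`∫ (kop κ)^[t] f dμ = ∫ f d(μK^t)`** for every Markov kernel `κ`, bounded measurable `f`, probability law
`μ` and time `t`. [ours, bookkeeping] -/
theorem integral_iterate_kop_eq_integral_iterate_bind (κ : Kernel Ω Ω) [IsMarkovKernel κ] :
    ∀ (t : ℕ) {f : Ω → ℝ}, Measurable f → ∀ {C : ℝ}, (∀ x, |f x| ≤ C) →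
      ∀ (μ : Measure Ω) [IsProbabilityMeasure μ],
        ∫ x, (kop κ)^[t] f x ∂μ = ∫ x, f x ∂((fun m : Measure Ω => m.bind κ)^[t] μ)
  | 0, f, _, _, _, μ, _ => by simp
  | t + 1, f, hf, C, hC, μ, _ => by
    obtain ⟨hgm, hgb⟩ := iterate_kop_bounded_measurable κ hf hC t
    rw [Function.iterate_succ_apply' (kop κ), Function.iterate_succ_apply (fun m : Measure Ω => m.bind κ)]
    have hint : Integrable ((kop κ)^[t] f) (κ ∘ₘ μ) := integrable_of_bounded _ hgm hgb
    have h1 : ∫ x, kop κ ((kop κ)^[t] f) x ∂μ = ∫ x, (kop κ)^[t] f x ∂(κ ∘ₘ μ) := by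
      rw [Measure.comp_eq_comp_const_apply] at hint ⊢
      rw [Kernel.integral_comp hint, Kernel.const_apply]
      rfl
    rw [h1]
    exact integral_iterate_kop_eq_integral_iterate_bind κ t hf hC (κ ∘ₘ μ)

/-- **The time-`t` marginal of the trajectory law from `μ₀` is `μ₀K^t`**: `E_{μ₀}[f(X_t)] = ∫ f d(μ₀K^t)` for
bounded measurable `f`. [ours] -/
theorem chain_expect_eq_integral_iterate_bind (κ : Kernel Ω Ω) [IsMarkovKernel κ] (μ₀ : Measure Ω)
    [IsProbabilityMeasure μ₀] {f : Ω → ℝ} (hf : Measurable f) {C : ℝ} (hC : ∀ x, |f x| ≤ C) (t : ℕ) :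
    ∫ x, f (x t) ∂(Kernel.trajMeasure (X := fun _ : ℕ => Ω) μ₀
        (fun n : ℕ => κ.comap (fun h : (i : ↥(Finset.Iic n)) → Ω => h ⟨n, Finset.mem_Iic.2 le_rfl⟩)
          (measurable_pi_apply _)))
      = ∫ x, f x ∂((fun m : Measure Ω => m.bind κ)^[t] μ₀) := by
  rw [chain_expect κ μ₀ hf hC t]
  exact integral_iterate_kop_eq_integral_iterate_bind κ t hf hC μ₀

/-- The expected time average is the average of the marginal expectations:
`E_{μ₀}[(1/N)Σ_{i<N} f(X_i)] = (1/N)Σ_{i<N} ∫ f d(μ₀K^i)`. [ours] -/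
theorem chain_timeAverage_eq_sum_integral_iterate_bind (κ : Kernel Ω Ω) [IsMarkovKernel κ] (μ₀ : Measure Ω)
    [IsProbabilityMeasure μ₀] {f : Ω → ℝ} (hf : Measurable f) {C : ℝ} (hC : ∀ x, |f x| ≤ C) (N : ℕ) :
    ∫ x, (∑ i ∈ Finset.range N, f (x i)) / N ∂(Kernel.trajMeasure (X := fun _ : ℕ => Ω) μ₀
        (fun n : ℕ => κ.comap (fun h : (i : ↥(Finset.Iic n)) → Ω => h ⟨n, Finset.mem_Iic.2 le_rfl⟩)
          (measurable_pi_apply _)))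
      = (∑ i ∈ Finset.range N, ∫ x, f x ∂((fun m : Measure Ω => m.bind κ)^[i] μ₀)) / N := by
  set P := Kernel.trajMeasure (X := fun _ : ℕ => Ω) μ₀
      (fun n : ℕ => κ.comap (fun h : (i : ↥(Finset.Iic n)) → Ω => h ⟨n, Finset.mem_Iic.2 le_rfl⟩)
        (measurable_pi_apply _)) with hP
  have hint : ∀ i, Integrable (fun x : ℕ → Ω => f (x i)) P := fun i =>
    integrable_of_bounded P (hf.comp (measurable_pi_apply i)) fun x => hC (x i)
  have hmean : ∫ x, (∑ i ∈ Finset.range N, f (x i)) / N ∂P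
      = (∑ i ∈ Finset.range N, ∫ x, f (x i) ∂P) / N := by
    rw [show (fun x : ℕ → Ω => (∑ i ∈ Finset.range N, f (x i)) / N)
        = fun x => (N : ℝ)⁻¹ * ∑ i ∈ Finset.range N, f (x i) by funext x; rw [div_eq_inv_mul],
      integral_const_mul, integral_finsetSum _ (fun i _ => hint i), ← div_eq_inv_mul]
  rw [hmean]
  congr 1
  refine sum_congr rfl fun i _ => ?_
  rw [hP, chain_expect_eq_integral_iterate_bind κ μ₀ hf hC i]

/-! ## §2 Flow-MCMC from a mode, on path space -/

variable [MeasurableSingletonClass Ω] {q : Measure Ω} [IsProbabilityMeasure q] {w : Ω → ℝ}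

/-- **`E_{x₀}[f(X_t)] − π f = r^t·(f(x₀) − π f)` on path space**, `r = 1 − 1/w(x₀)`; `w` measurable (as a `Fact`,
for the Markov-kernel instance), positive, normalised, maximal at `x₀`; `f` bounded measurable. [ours] -/
theorem imh_chain_expect_mode_sub [Fact (Measurable w)] (hw0 : ∀ y, 0 < w y) {x₀ : Ω} (hmax : ∀ y, w y ≤ w x₀)
    [IsProbabilityMeasure (q.withDensity fun y => ENNReal.ofReal (w y))]
    {f : Ω → ℝ} (hf : Measurable f) {C : ℝ} (hC : ∀ x, |f x| ≤ C) (t : ℕ) :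
    ∫ x, f (x t) ∂(Kernel.trajMeasure (X := fun _ : ℕ => Ω) (Measure.dirac x₀)
        (fun n : ℕ => (indepMH q w).comap (fun h : (i : ↥(Finset.Iic n)) → Ω => h ⟨n, Finset.mem_Iic.2 le_rfl⟩)
          (measurable_pi_apply _))) - ∫ x, f x ∂(q.withDensity fun y => ENNReal.ofReal (w y)) =
      (1 - (w x₀)⁻¹) ^ t * (f x₀ - ∫ x, f x ∂(q.withDensity fun y => ENNReal.ofReal (w y))) := by
  rw [chain_expect_eq_integral_iterate_bind (indepMH q w) (Measure.dirac x₀) hf hC t]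
  exact integral_iterate_bind_indepMH_dirac_mode_sub Fact.out hw0 hmax t (integrable_of_bounded _ hf hC)

/-- **THE EXACT TIME-AVERAGE BIAS OF THE COLD-STARTED RUN, ON PATH SPACE**:
`E_{x₀}[(1/N)Σ_{i<N} f(X_i)] − π f = (f(x₀) − π f)·S_N/N`, `S_N = Σ_{t<N}(1 − 1/w(x₀))^t`. [ours] -/
theorem imh_chain_timeAverage_bias_mode_eq [Fact (Measurable w)] (hw0 : ∀ y, 0 < w y) {x₀ : Ω}
    (hmax : ∀ y, w y ≤ w x₀) [IsProbabilityMeasure (q.withDensity fun y => ENNReal.ofReal (w y))]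
    {f : Ω → ℝ} (hf : Measurable f) {C : ℝ} (hC : ∀ x, |f x| ≤ C) {N : ℕ} (hN : N ≠ 0) :
    ∫ x, (∑ i ∈ Finset.range N, f (x i)) / N ∂(Kernel.trajMeasure (X := fun _ : ℕ => Ω) (Measure.dirac x₀)
        (fun n : ℕ => (indepMH q w).comap (fun h : (i : ↥(Finset.Iic n)) → Ω => h ⟨n, Finset.mem_Iic.2 le_rfl⟩)
          (measurable_pi_apply _))) - ∫ x, f x ∂(q.withDensity fun y => ENNReal.ofReal (w y)) =
      (f x₀ - ∫ x, f x ∂(q.withDensity fun y => ENNReal.ofReal (w y))) *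
        (∑ t ∈ Finset.range N, (1 - (w x₀)⁻¹) ^ t) / N := by
  have hNpos : (0 : ℝ) < N := by exact_mod_cast Nat.pos_of_ne_zero hN
  rw [chain_timeAverage_eq_sum_integral_iterate_bind (indepMH q w) (Measure.dirac x₀) hf hC N,
    ← sum_integral_iterate_bind_indepMH_dirac_mode_sub Fact.out hw0 hmax N (integrable_of_bounded _ hf hC),
    Finset.sum_sub_distrib, Finset.sum_const, Finset.card_range, nsmul_eq_mul]
  field_simp

/-- **TWO-SIDED, ON PATH SPACE**: `|f(x₀) − π f|/(1 + N/w(x₀)) ≤ |E_{x₀}[(1/N)Σ_{i<N} f(X_i)] − π f| ≤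
|f(x₀) − π f|·min(1, w(x₀)/N)` (`N ≥ 1`). [ours] -/
theorem imh_chain_timeAverage_bias_mode_two_sided [Fact (Measurable w)] (hw0 : ∀ y, 0 < w y) {x₀ : Ω}
    (hmax : ∀ y, w y ≤ w x₀) [IsProbabilityMeasure (q.withDensity fun y => ENNReal.ofReal (w y))]
    {f : Ω → ℝ} (hf : Measurable f) {C : ℝ} (hC : ∀ x, |f x| ≤ C) {N : ℕ} (hN : N ≠ 0) :
    |f x₀ - ∫ x, f x ∂(q.withDensity fun y => ENNReal.ofReal (w y))| * (1 / (1 + N * (w x₀)⁻¹)) ≤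
      |∫ x, (∑ i ∈ Finset.range N, f (x i)) / N ∂(Kernel.trajMeasure (X := fun _ : ℕ => Ω) (Measure.dirac x₀)
        (fun n : ℕ => (indepMH q w).comap (fun h : (i : ↥(Finset.Iic n)) → Ω => h ⟨n, Finset.mem_Iic.2 le_rfl⟩)
          (measurable_pi_apply _))) - ∫ x, f x ∂(q.withDensity fun y => ENNReal.ofReal (w y))| ∧
    |∫ x, (∑ i ∈ Finset.range N, f (x i)) / N ∂(Kernel.trajMeasure (X := fun _ : ℕ => Ω) (Measure.dirac x₀)
        (fun n : ℕ => (indepMH q w).comap (fun h : (i : ↥(Finset.Iic n)) → Ω => h ⟨n, Finset.mem_Iic.2 le_rfl⟩)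
          (measurable_pi_apply _))) - ∫ x, f x ∂(q.withDensity fun y => ENNReal.ofReal (w y))| ≤
      |f x₀ - ∫ x, f x ∂(q.withDensity fun y => ENNReal.ofReal (w y))| * min 1 (w x₀ / N) := by
  have hNpos : (0 : ℝ) < N := by exact_mod_cast Nat.pos_of_ne_zero hN
  have hW : 1 ≤ w x₀ := one_le_of_mode (q := q) hmax
  have hr0 : 0 ≤ 1 - (w x₀)⁻¹ := sub_nonneg.2 (inv_le_one_of_one_le₀ hW)
  have hS0 : 0 ≤ ∑ t ∈ range N, (1 - (w x₀)⁻¹) ^ t := sum_nonneg fun t _ => pow_nonneg hr0 t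
  rw [imh_chain_timeAverage_bias_mode_eq hw0 hmax hf hC hN, abs_div, abs_mul, abs_of_nonneg hS0,
    abs_of_pos hNpos, mul_div_assoc]
  have hge := geom_sum_mode_ge (q := q) hw0 hmax N
  have hle1 := geom_sum_mode_le_card (q := q) hw0 hmax N
  have hle2 := geom_sum_mode_le_weight (q := q) hw0 hmax N
  refine ⟨mul_le_mul_of_nonneg_left ?_ (abs_nonneg _), mul_le_mul_of_nonneg_left ?_ (abs_nonneg _)⟩
  · rw [le_div_iff₀ hNpos]
    calc 1 / (1 + N * (w x₀)⁻¹) * N = N / (1 + N * (w x₀)⁻¹) := by ring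
      _ ≤ _ := hge
  · rw [div_le_iff₀ hNpos]
    refine le_trans ?_ ((le_min hle1 hle2).trans_eq ?_)
    · exact le_rfl
    · rw [min_mul_of_nonneg _ _ hNpos.le, one_mul, div_mul_cancel₀ _ hNpos.ne']

/-! ## §3 The any-start certificate with the exact constant `ε = 1/w(x₀)` -/

omit [MeasurableSingletonClass Ω] in
/-- **THE ANY-START BIAS CERTIFICATE OF FLOW-MCMC WITH ITS EXACT DOEBLIN CONSTANT**: `w` normalised, maximal
at `x₀`; then `K(x, ·) ≥ (1/w(x₀))·π` from EVERY state, so for every initial law `μ₀`, every bounded measurable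
`f` (`|f| ≤ C`) and every `N ≥ 1`: `|E_{μ₀}[(1/N)Σ_{i<N} f(X_i)] − π f| ≤ 2(C + |π f|)·w(x₀)/N`
(`Scoring/ChainBurnIn.chain_timeAverage_bias_le_of_doeblin`).  By §2 the cold start incurs at least
`|f(x₀) − π f|/(1 + N/w(x₀))`: the certificate's `w(x₀)/N` law is attained up to a constant. [ours] -/
theorem imh_chain_timeAverage_bias_le_any_start [Fact (Measurable w)] (hw0 : ∀ y, 0 < w y) {x₀ : Ω}
    (hmax : ∀ y, w y ≤ w x₀) [IsProbabilityMeasure (q.withDensity fun y => ENNReal.ofReal (w y))]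
    (μ₀ : Measure Ω) [IsProbabilityMeasure μ₀]
    {f : Ω → ℝ} (hf : Measurable f) {C : ℝ} (hC : ∀ x, |f x| ≤ C) {N : ℕ} (hN : N ≠ 0) :
    |∫ x, (∑ i ∈ Finset.range N, f (x i)) / N ∂(Kernel.trajMeasure (X := fun _ : ℕ => Ω) μ₀
        (fun n : ℕ => (indepMH q w).comap (fun h : (i : ↥(Finset.Iic n)) → Ω => h ⟨n, Finset.mem_Iic.2 le_rfl⟩)
          (measurable_pi_apply _))) - ∫ x, f x ∂(q.withDensity fun y => ENNReal.ofReal (w y))| ≤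
      2 * (C + |∫ x, f x ∂(q.withDensity fun y => ENNReal.ofReal (w y))|) * w x₀ / N := by
  have hw : Measurable w := Fact.out
  have hW : 1 ≤ w x₀ := one_le_of_mode (q := q) hmax
  have hWpos : 0 < w x₀ := hw0 x₀
  have hmin : ∀ x {B : Set Ω}, MeasurableSet B →
      (ENNReal.ofReal (w x₀))⁻¹ * (q.withDensity fun y => ENNReal.ofReal (w y)) B ≤ indepMH q w x B :=
    fun x B hB => indepMH_apply_ge hw hw0 hmax x hB
  have hε0 : 0 < (ENNReal.ofReal (w x₀))⁻¹ := ENNReal.inv_pos.2 ENNReal.ofReal_ne_top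
  have h := chain_timeAverage_bias_le_of_doeblin (μ₀ := μ₀) (indepMH_invariant (q := q) hw hw0) hmin hε0 hf hC hN
  have htoReal : ((ENNReal.ofReal (w x₀))⁻¹).toReal = (w x₀)⁻¹ := by
    rw [ENNReal.toReal_inv, ENNReal.toReal_ofReal hWpos.le]
  rw [htoReal] at h
  calc _ ≤ 2 * (C + |∫ x, f x ∂(q.withDensity fun y => ENNReal.ofReal (w y))|) / ((w x₀)⁻¹ * N) := h
    _ = 2 * (C + |∫ x, f x ∂(q.withDensity fun y => ENNReal.ofReal (w y))|) * w x₀ / N := by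
        field_simp

end Summit.Ventures.LatticeQCDFlow.Exactness
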